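import Summits.QuantumFields.BalabanUV.T4Continuum.Support.NE3SpectralCut
import Mathlib.Analysis.InnerProductSpace.Adjoint
import HarnessLib

/-!
# T⁴ programme, node NE3 — row E-MLw-(w4)-P-curved, row K1 (file 2): THE SPECTRAL CUT OF A GRAM OPERATOR `D†D`

NE3 (node U1b), row NE3 OWNER `b2b-balaban-t4-ne3-p1` (gen 22), ruling ρ-g22-2, design `HOME/t4/b2b-balaban-t4-ne3-p1/g22/D-ne3p1-g22-1.md` S2;
on K1 file 1 `NE3SpectralCut` (abstract kit for a symmetric positive `T` with an energy `hD`).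

WHAT.  The kit is consumed with `T := D† ∘ D` for a linear map `D : E →ₗ[ℝ] F` between finite-dimensional real inner-product spaces
(in route H♮: `D = D_W`, the covariant derivative on periodic 𝔤-valued sections packaged à la leaf-01-g5's `PiLp` torus; `F` = 1-forms).
This file discharges the kit's two hypotheses for every such Gram operator — symmetry (Mathlib `LinearMap.isSymmetric_adjoint_comp_self`)
and the energy identity `⟪D†D v, v⟫ = ‖D v‖²` (`LinearMap.adjoint_inner_left`) — and restates the four facts of the cut with `D` only:
for `θ > 0` and the parts `c̃ = lowPart … θ v`, `ζ′ = highPart … θ v` of the Gram operator,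
* `c̃ + ζ′ = v`;
* `‖ζ′‖² ≤ θ⁻¹·‖D v‖²`                       (no small divisor above the cut);
* `‖D†D c̃‖² ≤ θ·‖D v‖²`                       (the low part's «divergence» is small);
* `⟪ζ′, D†D c̃⟫ = 0`                           (orthogonality across the cut);
* `‖D ζ′‖² ≤ ‖D v‖²`, `‖D c̃‖² ≤ ‖D v‖²`      (energies of the parts).

CONTENT ([folklore]; 0 sorry; 0 def — the operator is written `LinearMap.adjoint D ∘ₗ D` inline): `gram_isSymmetric`, `inner_gram_eq_norm_sq`,
`gram_lowPart_add_highPart`, `norm_sq_highPart_gram_le`, `norm_sq_gram_lowPart_le`, `inner_highPart_gram_lowPart`,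
`inner_apply_highPart_apply_lowPart`, `norm_sq_apply_highPart_le`, `norm_sq_apply_lowPart_le'`, `norm_sq_apply_eq_add`.

HONEST FRAMING.  Linear algebra; nothing about Bałaban's objects; (P♮)∕(ML_w) at the curved background, T-E_w and NE3 are NOT proved;
spine PROVED 0∕9; finite T⁴ rung (B)+1 — NOT infinite volume, NOT mass gap, NOT BetaPertH, NOT Clay.  PLACEMENT: `Summits/QuantumFields/BalabanUV/`.
-/

set_option autoImplicit false

open scoped InnerProductSpace

namespace Summit.QuantumFields.BalabanUV.T4Continuum.NE3SpectralCutGram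

open NE3SpectralCut

noncomputable section

variable {E F : Type*} [NormedAddCommGroup E] [InnerProductSpace ℝ E] [FiniteDimensional ℝ E]
  [NormedAddCommGroup F] [InnerProductSpace ℝ F] [FiniteDimensional ℝ F]

/-- The Gram operator `D† ∘ D` is symmetric (Mathlib). [folklore] -/
theorem gram_isSymmetric (D : E →ₗ[ℝ] F) : (LinearMap.adjoint D ∘ₗ D).IsSymmetric :=
  LinearMap.isSymmetric_adjoint_comp_self D

/-- THE ENERGY IDENTITY `⟪D†D v, v⟫ = ‖D v‖²`. [folklore] -/
theorem inner_gram_eq_norm_sq (D : E →ₗ[ℝ] F) (v : E) :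
    ⟪(LinearMap.adjoint D ∘ₗ D) v, v⟫_ℝ = ‖D v‖ ^ 2 := by
  rw [LinearMap.comp_apply, LinearMap.adjoint_inner_left, real_inner_self_eq_norm_sq]

/-- `c̃ + ζ′ = v` for the Gram operator's cut. [folklore] -/
theorem gram_lowPart_add_highPart (D : E →ₗ[ℝ] F) (θ : ℝ) (v : E) :
    lowPart (gram_isSymmetric D) θ v + highPart (gram_isSymmetric D) θ v = v :=
  lowPart_add_highPart _ θ v

/-- **NO SMALL DIVISOR ABOVE THE CUT**: `‖ζ′‖² ≤ θ⁻¹·‖D v‖²` (`θ > 0`). [folklore] -/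
theorem norm_sq_highPart_gram_le (D : E →ₗ[ℝ] F) {θ : ℝ} (hθ : 0 < θ) (v : E) :
    ‖highPart (gram_isSymmetric D) θ v‖ ^ 2 ≤ θ⁻¹ * ‖D v‖ ^ 2 :=
  norm_sq_highPart_le (gram_isSymmetric D) θ v (fun w => D w) (inner_gram_eq_norm_sq D) hθ

/-- **THE LOW PART'S DIVERGENCE IS SMALL**: `‖D†D c̃‖² ≤ θ·‖D v‖²` (`θ ≥ 0`). [folklore] -/
theorem norm_sq_gram_lowPart_le (D : E →ₗ[ℝ] F) {θ : ℝ} (hθ : 0 ≤ θ) (v : E) :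
    ‖(LinearMap.adjoint D ∘ₗ D) (lowPart (gram_isSymmetric D) θ v)‖ ^ 2 ≤ θ * ‖D v‖ ^ 2 :=
  norm_sq_apply_lowPart_le_energy (gram_isSymmetric D) θ v (fun w => D w) (inner_gram_eq_norm_sq D) hθ

/-- **ORTHOGONALITY ACROSS THE CUT**: `⟪ζ′, D†D c̃⟫ = 0`. [folklore] -/
theorem inner_highPart_gram_lowPart (D : E →ₗ[ℝ] F) (θ : ℝ) (v : E) :
    ⟪highPart (gram_isSymmetric D) θ v, (LinearMap.adjoint D ∘ₗ D) (lowPart (gram_isSymmetric D) θ v)⟫_ℝ = 0 :=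
  inner_highPart_apply_lowPart _ θ v

/-- The same orthogonality moved onto `D`: `⟪D ζ′, D c̃⟫ = 0`. [folklore] -/
theorem inner_apply_highPart_apply_lowPart (D : E →ₗ[ℝ] F) (θ : ℝ) (v : E) :
    ⟪D (highPart (gram_isSymmetric D) θ v), D (lowPart (gram_isSymmetric D) θ v)⟫_ℝ = 0 := by
  have h := inner_highPart_gram_lowPart D θ v
  rwa [LinearMap.comp_apply, LinearMap.adjoint_inner_right] at h

/-- Energy of the high part: `‖D ζ′‖² ≤ ‖D v‖²`. [folklore] -/
theorem norm_sq_apply_highPart_le (D : E →ₗ[ℝ] F) (θ : ℝ) (v : E) :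
    ‖D (highPart (gram_isSymmetric D) θ v)‖ ^ 2 ≤ ‖D v‖ ^ 2 :=
  energy_highPart_le (gram_isSymmetric D) θ v (fun w => D w) (inner_gram_eq_norm_sq D)

/-- Energy of the low part: `‖D c̃‖² ≤ ‖D v‖²`. [folklore] -/
theorem norm_sq_apply_lowPart_le' (D : E →ₗ[ℝ] F) (θ : ℝ) (v : E) :
    ‖D (lowPart (gram_isSymmetric D) θ v)‖ ^ 2 ≤ ‖D v‖ ^ 2 :=
  energy_lowPart_le (gram_isSymmetric D) θ v (fun w => D w) (inner_gram_eq_norm_sq D)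

/-- **PYTHAGORAS FOR THE ENERGIES**: `‖D v‖² = ‖D c̃‖² + ‖D ζ′‖²`. [folklore] -/
theorem norm_sq_apply_eq_add (D : E →ₗ[ℝ] F) (θ : ℝ) (v : E) :
    ‖D v‖ ^ 2 = ‖D (lowPart (gram_isSymmetric D) θ v)‖ ^ 2 + ‖D (highPart (gram_isSymmetric D) θ v)‖ ^ 2 := by
  have h := inner_apply_lowPart_add (gram_isSymmetric D) θ v
  rw [inner_gram_eq_norm_sq, inner_gram_eq_norm_sq, inner_gram_eq_norm_sq] at h
  linarith

end

end Summit.QuantumFields.BalabanUV.T4Continuum.NE3SpectralCutGram
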